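import Mathlib
import HarnessLib
import Summits.ValiantsHypothesis.ValiantsHypothesis.Theorems.MonotoneRestorationOrbitRestorationQPSmlDeltaCalculus

/-!
# Chain rule for forgetting the column index: `x_{ab} ↦ y_a`
(crux `OrbitRestorationQP`, stmt-ValiantsHypothesis-18293 — lane SML: the column-set-multilinear `ΣΠΣ` stratum of A_∞)

The dictionary of the set-multilinear stratum (blueprint `SML-STRATUM-BLUEPRINT.md`, F5a): for a polynomial `g` in matrix
variables `x_{(a,b)}` put `p = rename Prod.fst g` (substitute `x_{ab} ↦ y_a`).  Then

* `pderiv_rename_fst` — `∂_a p = Σ_b rename fst (∂_{(a,b)} g)` (chain rule);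
* `pderivFold_rename_fst` — iterated: `∂_{ρ(0)} ⋯ ∂_{ρ(j-1)} p = Σ_{κ : Fin j → τ} rename fst (∂_{(ρ 0, κ 0)} ⋯ g)`
  (both sides as the def-free `List.foldl (fun q i => pderiv _ q) _ (List.finRange j)`);
* `isSymmetric_rename_fst` — row symmetry of `g` makes `p` symmetric;
* `isHomogeneous_colSml` / `rename_fst_colSml` — a column-set-multilinear `ΣΠΣ` expression
  `Σ_t Π_b (Σ_a α_{t,b,a} x_{ab})` is homogeneous of degree `n`, and so is its image `Σ_t Π_b (Σ_a α_{t,b,a} y_a)`.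
[folklore]
-/

set_option linter.dupNamespace false

namespace Summit.ValiantsHypothesis.ValiantsHypothesis.Theorems.SmlChainRule

open MvPolynomial SmlDeltaCalculus

variable {σ τ : Type*}

/-- **Chain rule** for `x_{(a,b)} ↦ y_a`: `∂_a (rename fst g) = Σ_b rename fst (∂_{(a,b)} g)`. [folklore] -/
theorem pderiv_rename_fst [Fintype τ] [DecidableEq σ] [DecidableEq τ] (a : σ) (g : MvPolynomial (σ × τ) ℂ) :
    pderiv a (rename Prod.fst g) = ∑ b : τ, rename Prod.fst (pderiv (a, b) g) := by
  induction g using MvPolynomial.induction_on with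
  | C c => simp
  | add p q hp hq => simp only [map_add, hp, hq, Finset.sum_add_distrib]
  | mul_X p v ih =>
    obtain ⟨a', b'⟩ := v
    rw [map_mul, rename_X, pderiv_mul, ih, Finset.sum_mul]
    simp_rw [pderiv_mul, map_add, map_mul, rename_X]
    rw [Finset.sum_add_distrib, ← Finset.mul_sum]
    congr 2
    -- the term `∂_a (X a')` versus `Σ_b rename fst (∂_{(a,b)} X_{(a',b')})`
    simp only [pderiv_X, Pi.single_apply, Prod.mk.injEq]
    by_cases h : a' = a
    · subst h
      rw [Finset.sum_eq_single b']
      · simp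
      · intro b _ hb; simp [Ne.symm hb]
      · intro h; exact absurd (Finset.mem_univ _) h
    · simp [h]

/-- The iterated partial derivative fold kills `0`. [folklore] -/
theorem pderivFoldList_zero {ι υ : Type*} (ρ : ι → υ) :
    ∀ l : List ι, List.foldl (fun (q : MvPolynomial υ ℂ) i => pderiv (ρ i) q) 0 l = 0 := by
  intro l
  induction l with
  | nil => rfl
  | cons i l ih => simp only [List.foldl_cons, map_zero]; exact ih

/-- The iterated partial derivative fold commutes with finite sums. [folklore] -/
theorem pderivFoldList_sum {ι υ κ : Type*} (ρ : ι → υ) (l : List ι) (s : Finset κ) (q : κ → MvPolynomial υ ℂ) :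
    List.foldl (fun (q : MvPolynomial υ ℂ) i => pderiv (ρ i) q) (∑ x ∈ s, q x) l =
      ∑ x ∈ s, List.foldl (fun (q : MvPolynomial υ ℂ) i => pderiv (ρ i) q) (q x) l := by
  classical
  induction s using Finset.induction_on with
  | empty => simp only [Finset.sum_empty]; exact pderivFoldList_zero ρ l
  | insert x s hx ih => rw [Finset.sum_insert hx, Finset.sum_insert hx, pderivFoldList_add, ih]

/-- **Iterated chain rule**: `∂_ρ (rename fst g) = Σ_{κ : Fin j → τ} rename fst (∂_{(ρ,κ)} g)`. [folklore] -/
theorem pderivFold_rename_fst [Fintype τ] [DecidableEq σ] [DecidableEq τ] :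
    ∀ (j : ℕ) (ρ : Fin j → σ) (g : MvPolynomial (σ × τ) ℂ),
      List.foldl (fun (q : MvPolynomial σ ℂ) i => pderiv (ρ i) q) (rename Prod.fst g) (List.finRange j) =
        ∑ κ : Fin j → τ, rename Prod.fst
          (List.foldl (fun (q : MvPolynomial (σ × τ) ℂ) i => pderiv (ρ i, κ i) q) g (List.finRange j)) := by
  intro j
  induction j with
  | zero =>
    intro ρ g
    simp [List.finRange_zero]
  | succ j ih =>
    intro ρ g
    rw [List.finRange_succ, List.foldl_cons, List.foldl_map, pderiv_rename_fst, pderivFoldList_sum]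
    simp only [ih]
    -- re-index `κ = Fin.cons b κ'`
    rw [← (Fin.consEquiv fun _ : Fin (j + 1) => τ).sum_comp, Fintype.sum_prod_type]
    refine Finset.sum_congr rfl fun b _ => Finset.sum_congr rfl fun κ' _ => ?_
    rw [List.foldl_cons, List.foldl_map]
    rfl

/-- Row symmetry of `g` (invariance under `(a,b) ↦ (σ a, b)`) makes `rename fst g` a symmetric polynomial. [folklore] -/
theorem isSymmetric_rename_fst {n : ℕ} (g : MvPolynomial (Fin n × τ) ℂ)
    (hrow : ∀ e : Equiv.Perm (Fin n), rename (fun v : Fin n × τ => (e v.1, v.2)) g = g) :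
    (rename (Prod.fst : Fin n × τ → Fin n) g).IsSymmetric := by
  intro e
  conv_rhs => rw [← hrow e]
  rw [rename_rename, rename_rename]
  rfl

/-- A column-set-multilinear `ΣΠΣ` expression `Σ_t Π_b (Σ_a α_{t,b,a} · x_{(a,b)})` is homogeneous of degree `|columns|`.
[folklore] -/
theorem isHomogeneous_colSml [Fintype τ] [Fintype σ] {s : ℕ} (α : Fin s → τ → σ → ℂ) :
    (∑ t : Fin s, ∏ b : τ, ∑ a : σ, C (α t b a) * X (a, b) : MvPolynomial (σ × τ) ℂ).IsHomogeneous
      (Fintype.card τ) := by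
  refine IsHomogeneous.sum _ _ _ fun t _ => ?_
  have h := IsHomogeneous.prod (Finset.univ : Finset τ)
    (fun b => ∑ a : σ, C (α t b a) * X (a, b) : τ → MvPolynomial (σ × τ) ℂ) (fun _ => 1) fun b _ =>
      IsHomogeneous.sum _ _ _ fun a _ => by
        simpa using (isHomogeneous_C (σ × τ) (α t b a)).mul (isHomogeneous_X ℂ (a, b))
  simpa using h

/-- The image of a column-set-multilinear expression under `x_{(a,b)} ↦ y_a`. [folklore] -/
theorem rename_fst_colSml [Fintype τ] [Fintype σ] {s : ℕ} (α : Fin s → τ → σ → ℂ) :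
    rename (Prod.fst : σ × τ → σ) (∑ t : Fin s, ∏ b : τ, ∑ a : σ, C (α t b a) * X (a, b)) =
      ∑ t : Fin s, ∏ b : τ, ∑ a : σ, C (α t b a) * X a := by
  simp only [map_sum, map_prod, map_mul, rename_C, rename_X]

/-- The image `Σ_t Π_b (Σ_a α_{t,b,a} y_a)` is homogeneous of degree `|columns|`. [folklore] -/
theorem isHomogeneous_rename_fst_colSml [Fintype τ] [Fintype σ] {s : ℕ} (α : Fin s → τ → σ → ℂ) :
    (∑ t : Fin s, ∏ b : τ, ∑ a : σ, C (α t b a) * X a : MvPolynomial σ ℂ).IsHomogeneous (Fintype.card τ) := by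
  refine IsHomogeneous.sum _ _ _ fun t _ => ?_
  have h := IsHomogeneous.prod (Finset.univ : Finset τ)
    (fun b => ∑ a : σ, C (α t b a) * X a : τ → MvPolynomial σ ℂ) (fun _ => 1) fun b _ =>
      IsHomogeneous.sum _ _ _ fun a _ => by
        simpa using (isHomogeneous_C σ (α t b a)).mul (isHomogeneous_X ℂ a)
  simpa using h

end Summit.ValiantsHypothesis.ValiantsHypothesis.Theorems.SmlChainRule
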